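import Literature.AlgebraicGeometry.Motives.TangentLinesChowTwo
import Literature.AlgebraicGeometry.Motives.CubicThreePlaneSectionPlanes
import Literature.AlgebraicGeometry.Motives.SmoothHypersurfaceJacobianCriterion
import Literature.AlgebraicGeometry.Motives.VarietiesGeometricallyIntegralProofs
import Literature.AlgebraicGeometry.Motives.LinearSubspacesChowNonTorsion
import HarnessLib

/-!
# `CH₂` of a smooth cubic hypersurface of dimension `n ≥ 14` is generated by planes

R. Mboro, *Remarks on the `CH₂` of cubic hypersurfaces* (arXiv:1701.04488), Cor. 2.9 (= Cor. 6 of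
the introduction; the named fact `Mboro2018_chowTwo_cubic` of `Motives/LinearSubspacesGenerateChow`,
bounds `n ≥ 7` for generation by planes and `n ≥ 9` for `CH₂(X) ≃ ℤ`). The tree proves the
conclusion for `n ≥ 18` (`Motives/PlanesGenerateChowTwoOfCubic`, Tian–Zong's product trick one
dimension up). This file lowers the range to **`n ≥ 14` for generation by planes** and
**`n ≥ 15` for `CH₂(X) ≃ ℤ`**, following the architecture of Mboro's own proof — two relations
with coprime coefficients:

* `3 · CH₂(X) ⊆ ℤ h + ⟨planes⟩` (Thm. 1.2, osculating lines; `Motives/OsculatingLinesChowTwo`) and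
  `2 · CH₂(X) ⊆ ℤ h + ⟨planes⟩` (tangent lines aimed at a plane of `X`, the lines of the proof of
  Thm. 1.3; `Motives/TangentLinesChowTwo`), whence `CH₂(X) = ℤ h + ⟨planes⟩` for every integral
  cubic hypersurface of dimension `d ≥ 14` (`h = c₁(𝒪_X(1))^{d-2} ∩ [X]`);
* `h ∈ ⟨planes⟩` when the equation of `X` has non-vanishing gradient at its non-zero zeros
  (`Motives/CubicThreePlaneSectionPlanes`: two planes of `X` in a line span a `3`-plane `M ⊄ X`,
  and `X ∩ M` is three planes — Mboro's "`H_X^{n-2} ∈ Im(P_*)`", "`𝒫 ∈ Im(P_*)`"), which holds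
  for smooth `X` by the Jacobian criterion (`Motives/SmoothHypersurfaceJacobianCriterion`).

Main statements:
* `Hypersurface.closure_linearSubspaceClasses_two_eq_top` — `⟨plane classes⟩ = CH₂(X)` for an
  integral cubic hypersurface `X ⊆ ℙᵈ⁺¹` (`d ≥ 14`) with non-vanishing gradient;
* `Hypersurface.chowGeneratedByLinearSubspaces_two_of_fourteen_le` — the cycle-level rendering
  `ChowGeneratedByLinearSubspaces 2 (n + 1) i` for a smooth cubic `n`-fold, `n ≥ 14` (input (a) of
  `Mboro2018_chowTwo_cubic_of_inputs` in this range);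
* `Hypersurface.chowTwo_cubic_of_fifteen_le`, `Mboro2018_chowTwo_cubic_of_fifteen_le` — both
  clauses of the fact for `n ≥ 15` (`CH₂(X) ≃ ℤ` from generation by planes by
  `Hypersurface.nonempty_addEquiv_int_of_chowGeneratedByPlanes`, `Motives/CubicHypersurfacePlanesRatEquiv`);
* `Mboro2018_chowTwo_cubic_clause_i_of_fourteen_le` — clause (i) of the fact for `n ≥ 14`.

What remains of the fact is `7 ≤ n ≤ 13` for (i) and `9 ≤ n ≤ 14` for (ii) (Mboro's Thm. 1.3 via
the Clemens–Griffiths parametrisation, Thm. 2.8 via bend-and-break, and the rational chain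
connectedness of the Fano schemes of lines and planes). Everything here is proved; no named facts.

## References

* [Mboro2018] R. Mboro, Remarks on the CH₂ of cubic hypersurfaces, Geom. Dedicata 200 (2018) =
  arXiv:1701.04488: Thm. 1.2, Thm. 1.3, Prop. 1.4 (pp. 6–8), Cor. 2.9 (p. 12).
* [Hartshorne1977] R. Hartshorne, Algebraic Geometry (1977), I Thm. 5.1, Ex. 5.8 (Jacobian criterion).
* [TianZong2014] Z. Tian, H. R. Zong, One-cycles on rationally connected varieties, Compositio
  Math. 150 (2014), Prop. 7.2 (the family technique).
-/

noncomputable section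

open CategoryTheory AlgebraicGeometry Order MvPolynomial
open Literature.AlgebraicGeometry.Motives.Segre

universe u

namespace Literature.AlgebraicGeometry.Motives

attribute [local instance] MvPolynomial.gradedAlgebra

namespace Hypersurface

open ProjSpace ProjectiveSpace ProjectiveSpaceCells Literature.RingTheory.MvPolynomial

section Integral

variable {k : Type u} [Field k] [IsAlgClosed k] {d : ℕ} (X : SchemeOver k) [IsIntegral X.left]
  [LocallyOfFiniteType X.hom] (i : X ⟶ projectiveSpace (d + 1) k) [IsClosedImmersion i.left]
  {F : MvPolynomial (Fin (d + 1 + 1)) k}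

/-- **`CH₂(X)` is generated by the plane classes** for an integral cubic hypersurface
`X = V₊(F) ⊆ ℙᵈ⁺¹_k` over an algebraically closed field, `d ≥ 14`, whose equation has
non-vanishing gradient at every non-zero zero (e.g. `X` smooth): `CH₂(X) = ℤ h + ⟨planes⟩`
(`ProjFamily.mem_zmultiples_sup_closure_linearSubspaceClasses`, Mboro Thms. 1.2–1.3 in this range)
and `h ∈ ⟨planes⟩` (`hyperplaneSectionOnIter_two_mem_closure_linearSubspaceClasses`).
[cite: Mboro2018, Cor. 2.9 with Thm. 1.2, Thm. 1.3 and Prop. 1.4 (arXiv:1701.04488, pp. 6–8, 12)] -/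
theorem closure_linearSubspaceClasses_two_eq_top (hd : 14 ≤ d)
    (hF : F ∈ grading (Fin (d + 1 + 1)) k 3) (hprime : Prime F)
    (hrange : Set.range i.left.base =
      ProjectiveSpectrum.zeroLocus (MvPolynomial.homogeneousSubmodule (Fin (d + 1 + 1)) k) {F})
    (hJ : ∀ z : Fin (d + 1 + 1) → k, z ≠ 0 → eval z F = 0 → ∃ j, eval z (pderiv j F) ≠ 0) :
    AddSubgroup.closure (linearSubspaceClasses 2 (d + 1) i) = ⊤ := by
  have hF3 : F.IsHomogeneous 3 := (mem_homogeneousSubmodule 3 F).1 hF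
  -- a hyperplane `V₊(ℓ₀) ⊅ X`
  obtain ⟨ℓv, hlin, hhom, hFℓ⟩ := exists_linearForms_not_mem_idealSpan (N := d + 1) three_pos hF3
    hprime.ne_zero (c := 1) (by omega)
  have hℓ₀ : ℓv 0 ∈ grading (Fin (d + 1 + 1)) k 1 := (mem_homogeneousSubmodule 1 _).2 (hhom 0)
  have hℓ₀0 : ℓv 0 ≠ 0 := hlin.ne_zero 0
  have hX₀ : (formDivisor (ℓv 0) hℓ₀ hℓ₀0).Avoids (i.left.base (genericPoint ↥X.left)) := by
    refine formDivisor_avoids_base_genericPoint i hF hprime hrange hℓ₀ hℓ₀0 fun h => hFℓ ?_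
    exact Ideal.span_mono (Set.singleton_subset_iff.2 (Set.mem_range_self 0)) h
  have hdim : 2 + (d - 2) = d := by omega
  rw [eq_top_iff]
  intro γ _
  have hmem := ProjFamily.mem_zmultiples_sup_closure_linearSubspaceClasses X i hd hF hprime hrange hdim
    hℓ₀ hℓ₀0 hX₀ γ
  have hh := hyperplaneSectionOnIter_two_mem_closure_linearSubspaceClasses i (by omega) hF hprime hrange
    hJ hdim hℓ₀ hℓ₀0 hX₀
  exact (sup_le (AddSubgroup.zmultiples_le_of_mem hh) le_rfl) hmem

/-- The cycle-level rendering: **every `2`-cycle on `X` is rationally equivalent to an integral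
combination of planes of `X`** (`ChowGeneratedByLinearSubspaces 2 (d + 1) i`), for an integral cubic
hypersurface of dimension `d ≥ 14` with non-vanishing gradient. [cite: Mboro2018, Cor. 2.9 (arXiv:1701.04488, p. 12)] -/
theorem chowGeneratedByLinearSubspaces_two_of_gradient (hd : 14 ≤ d)
    (hF : F ∈ grading (Fin (d + 1 + 1)) k 3) (hprime : Prime F)
    (hrange : Set.range i.left.base =
      ProjectiveSpectrum.zeroLocus (MvPolynomial.homogeneousSubmodule (Fin (d + 1 + 1)) k) {F})
    (hJ : ∀ z : Fin (d + 1 + 1) → k, z ≠ 0 → eval z F = 0 → ∃ j, eval z (pderiv j F) ≠ 0) :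
    ChowGeneratedByLinearSubspaces 2 (d + 1) i :=
  chowGeneratedByLinearSubspaces_of_closure_eq_top
    (closure_linearSubspaceClasses_two_eq_top X i hd hF hprime hrange hJ)

end Integral

/-! ### In the binders of the named fact -/

section Fact

/-- **Input (a) of Mboro's Cor. 2.9 for `n ≥ 14`: the `CH₂` of a smooth cubic hypersurface of
dimension `n ≥ 14` over an algebraically closed field is generated by planes** — in the binders of
`Mboro2018_chowTwo_cubic` (`X` smooth projective of dimension `n`, `F` an irreducible cubic form,
`i : X ↪ ℙⁿ⁺¹_k` a closed immersion with image `V₊(F)`): `X` is integral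
(`IsSmoothProjective.isIntegral_holds`), `F` is prime, and the gradient of `F` vanishes at no
non-zero zero (`IsSmoothProjective.exists_eval_pderiv_ne_zero`, the Jacobian criterion), so
`chowGeneratedByLinearSubspaces_two_of_gradient` applies. [cite: Mboro2018, Cor. 2.9 (arXiv:1701.04488, p. 12)] [cite: Hartshorne1977, I Thm. 5.1 and Ex. 5.8] -/
theorem chowGeneratedByLinearSubspaces_two_of_fourteen_le {k : Type u} [Field k] [IsAlgClosed k]
    (n : ℕ) {X : SchemeOver k} (F : MvPolynomial (Fin (n + 1 + 1)) k) (i : X ⟶ projectiveSpace (n + 1) k)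
    (hX : IsSmoothProjective n X) (hF : F.IsHomogeneous 3) (hirr : Irreducible F)
    [hi : IsClosedImmersion i.left]
    (hV : Set.range i.left.base =
      ProjectiveSpectrum.zeroLocus (MvPolynomial.homogeneousSubmodule (Fin (n + 1 + 1)) k) {F})
    (hn : 14 ≤ n) :
    ChowGeneratedByLinearSubspaces 2 (n + 1) i := by
  haveI : IsIntegral X.left := IsSmoothProjective.isIntegral_holds hX
  haveI : IsProper (projectiveSpace (n + 1) k).hom := isProper_projectiveSpace (n + 1) k
  haveI : LocallyOfFiniteType X.hom := by rw [← Over.w i]; infer_instance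
  have hprime : Prime F := UniqueFactorizationMonoid.irreducible_iff_prime.1 hirr
  have hFg : F ∈ grading (Fin (n + 1 + 1)) k 3 := (mem_homogeneousSubmodule 3 F).2 hF
  have hJ : ∀ z : Fin (n + 1 + 1) → k, z ≠ 0 → eval z F = 0 → ∃ j, eval z (pderiv j F) ≠ 0 :=
    fun z hz hFz => IsSmoothProjective.exists_eval_pderiv_ne_zero hX hF hirr i hV hz hFz
  exact chowGeneratedByLinearSubspaces_two_of_gradient X i hn hFg hprime hV hJ

/-- **`CH₂` of a smooth cubic hypersurface of dimension `n ≥ 15` is generated by planes and is `ℤ`**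
— both clauses of the conclusion of `Mboro2018_chowTwo_cubic` (bounds `7` and `9` in the paper) in
the range `n ≥ 15`: generation by planes from `chowGeneratedByLinearSubspaces_two_of_fourteen_le`,
and `CH₂(X) ≃ ℤ` from it by `nonempty_addEquiv_int_of_chowGeneratedByPlanes`
(`Motives/CubicHypersurfacePlanesRatEquiv`: any two planes are rationally equivalent for `n ≥ 15`,
and plane classes are non-torsion). [cite: Mboro2018, Cor. 2.9 (arXiv:1701.04488, p. 12)] -/
theorem chowTwo_cubic_of_fifteen_le {k : Type u} [Field k] [IsAlgClosed k] [CharZero k]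
    (n : ℕ) {X : SchemeOver k} (F : MvPolynomial (Fin (n + 1 + 1)) k) (i : X ⟶ projectiveSpace (n + 1) k)
    (hX : IsSmoothProjective n X) (hF : F.IsHomogeneous 3) (hirr : Irreducible F)
    [hi : IsClosedImmersion i.left]
    (hV : Set.range i.left.base =
      ProjectiveSpectrum.zeroLocus (MvPolynomial.homogeneousSubmodule (Fin (n + 1 + 1)) k) {F})
    (hn : 15 ≤ n) :
    ChowGeneratedByLinearSubspaces 2 (n + 1) i ∧ Nonempty (ChowGroup X.left 2 ≃+ ℤ) := by
  have hgen := chowGeneratedByLinearSubspaces_two_of_fourteen_le n F i hX hF hirr hV (by omega)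
  exact ⟨hgen, nonempty_addEquiv_int_of_chowGeneratedByPlanes n F i hX hF hirr hV hn hgen⟩

end Fact

end Hypersurface

/-- The statement of `Mboro2018_chowTwo_cubic` with its two clauses, under the extra hypothesis
`15 ≤ n` (in which range both `7 ≤ n` and `9 ≤ n` hold): proved. [cite: Mboro2018, Cor. 2.9] -/
theorem Mboro2018_chowTwo_cubic_of_fifteen_le :
    ∀ ⦃k : Type u⦄ [Field k] [IsAlgClosed k] [CharZero k] (n : ℕ) ⦃X : SchemeOver k⦄
      (F : MvPolynomial (Fin (n + 1 + 1)) k) (i : X ⟶ projectiveSpace (n + 1) k),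
      IsSmoothProjective n X → F.IsHomogeneous 3 → Irreducible F → IsClosedImmersion i.left →
        Set.range i.left.base =
          ProjectiveSpectrum.zeroLocus (MvPolynomial.homogeneousSubmodule (Fin (n + 1 + 1)) k) {F} →
        15 ≤ n →
          (7 ≤ n → ChowGeneratedByLinearSubspaces 2 (n + 1) i) ∧
            (9 ≤ n → Nonempty (ChowGroup X.left 2 ≃+ ℤ)) := by
  intro k _ _ _ n X F i hX hF hirr hi hV hn
  obtain ⟨h1, h2⟩ := Hypersurface.chowTwo_cubic_of_fifteen_le n F i hX hF hirr hV hn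
  exact ⟨fun _ => h1, fun _ => h2⟩

/-- Clause (i) of `Mboro2018_chowTwo_cubic` (generation of `CH₂` by planes), under the extra
hypothesis `14 ≤ n`: proved (the characteristic-zero hypothesis of the fact is not used).
[cite: Mboro2018, Cor. 2.9] -/
theorem Mboro2018_chowTwo_cubic_clause_i_of_fourteen_le :
    ∀ ⦃k : Type u⦄ [Field k] [IsAlgClosed k] (n : ℕ) ⦃X : SchemeOver k⦄
      (F : MvPolynomial (Fin (n + 1 + 1)) k) (i : X ⟶ projectiveSpace (n + 1) k),
      IsSmoothProjective n X → F.IsHomogeneous 3 → Irreducible F → IsClosedImmersion i.left →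
        Set.range i.left.base =
          ProjectiveSpectrum.zeroLocus (MvPolynomial.homogeneousSubmodule (Fin (n + 1 + 1)) k) {F} →
        14 ≤ n → ChowGeneratedByLinearSubspaces 2 (n + 1) i := by
  intro k _ _ n X F i hX hF hirr hi hV hn
  exact Hypersurface.chowGeneratedByLinearSubspaces_two_of_fourteen_le n F i hX hF hirr hV hn

/-! ### What remains of the fact: the low ranges -/

/-- **Reduction of `Mboro2018_chowTwo_cubic` to its low ranges.** The named fact follows from
(a') generation of `2`-cycles by planes for smooth cubic hypersurfaces of dimension `7 ≤ n ≤ 13`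
and (b') rational equivalence of any two planes for `9 ≤ n ≤ 14` only: above these ranges both
inputs of `Mboro2018_chowTwo_cubic_of_inputs` (`Motives/LinearSubspacesChowNonTorsion`) are theorems
(`Hypersurface.chowGeneratedByLinearSubspaces_two_of_fourteen_le` and
`Hypersurface.isRationallyEquivalent_of_isLinearSubspacePoint_two`, `Motives/CubicHypersurfacePlanesRatEquiv`).
In print the low ranges are Prop. 1.4 + Thm. 1.3 + Thm. 2.8 (the universal line, the degree-`2`
unirational parametrisation, bend-and-break on `F(X)`) and Debarre–Manivel's `CH₀(F₂(X)) = ℤ`.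
[cite: Mboro2018, Cor. 2.9 and its proof (arXiv:1701.04488, p. 12)] -/
theorem Mboro2018_chowTwo_cubic_of_low_inputs
    (ha : ∀ ⦃k : Type u⦄ [Field k] [IsAlgClosed k] [CharZero k] (n : ℕ) ⦃X : SchemeOver k⦄
      (F : MvPolynomial (Fin (n + 1 + 1)) k) (i : X ⟶ projectiveSpace (n + 1) k),
      IsSmoothProjective n X → F.IsHomogeneous 3 → Irreducible F → IsClosedImmersion i.left →
        Set.range i.left.base =
          ProjectiveSpectrum.zeroLocus (MvPolynomial.homogeneousSubmodule (Fin (n + 1 + 1)) k) {F} →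
          7 ≤ n → n ≤ 13 → ∀ z : ↥X.left, Order.height z = 2 →
            ∃ (s : Finset ↥X.left) (w : ↥X.left → ℤ),
              (∀ y ∈ s, IsLinearSubspacePoint 2 (n + 1) i y) ∧
                IsRationallyEquivalent (primeCycle z) (∑ y ∈ s, w y • primeCycle y) 2)
    (hb : ∀ ⦃k : Type u⦄ [Field k] [IsAlgClosed k] [CharZero k] (n : ℕ) ⦃X : SchemeOver k⦄
      (F : MvPolynomial (Fin (n + 1 + 1)) k) (i : X ⟶ projectiveSpace (n + 1) k),
      IsSmoothProjective n X → F.IsHomogeneous 3 → Irreducible F → IsClosedImmersion i.left →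
        Set.range i.left.base =
          ProjectiveSpectrum.zeroLocus (MvPolynomial.homogeneousSubmodule (Fin (n + 1 + 1)) k) {F} →
          9 ≤ n → n ≤ 14 → ∀ ⦃z z' : ↥X.left⦄, IsLinearSubspacePoint 2 (n + 1) i z →
            IsLinearSubspacePoint 2 (n + 1) i z' →
              IsRationallyEquivalent (primeCycle z) (primeCycle z') 2) :
    Mboro2018_chowTwo_cubic.{u} := by
  refine Mboro2018_chowTwo_cubic_of_inputs ?_ ?_
  · intro k _ _ _ n X F i hX hF hirr hi hV h7 z hz
    by_cases h13 : n ≤ 13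
    · exact ha n F i hX hF hirr hi hV h7 h13 z hz
    · exact Hypersurface.chowGeneratedByLinearSubspaces_two_of_fourteen_le n F i hX hF hirr hV (by omega)
        (primeCycle z) (primeCycle_mem_cyclesOfDim hz)
  · intro k _ _ _ n X F i hX hF hirr hi hV h9 z z' hz hz'
    by_cases h14 : n ≤ 14
    · exact hb n F i hX hF hirr hi hV h9 h14 hz hz'
    · exact Hypersurface.isRationallyEquivalent_of_isLinearSubspacePoint_two n F i hX hF hirr hV (by omega) hz hz'

end Literature.AlgebraicGeometry.Motives

end
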